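/-
Copyright: the b2b-balaban T⁴-continuum CRUX team, row NE7b OWNER lineage `t4-ne7b-p1` (gen 142). Project licence.
-/
import Summits.QuantumFields.BalabanUV.T4Continuum.Spine.NE7b.SupTruncationFiveBound
import Summits.QuantumFields.BalabanUV.T4Continuum.Spine.NE7b.SupTruncationFiveMoments
import Summits.QuantumFields.BalabanUV.T4Continuum.Spine.NE7b.SupDobrushinGroupCovarianceFive

/-!
# THE TWO ORDER-FIVE GROUP BOUNDS UNDER THE GIBBS LAW (SCOPING (d14)(2)(ii), fourth analytic order-five file — the order-5 analogue of (489) §2 ∕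
# (490)).  In the abstract Gibbs format of (447)∕(461) (potential `V` on `ℝ^ι`, one-site floors `c`, Dobrushin matrix `J∕c` with rows `≤ γ < 1`,
# admissible `D`), five class observables `F₁,…,F₅` (vectors `a_i`), centred (`f_i = F_i − m_i`), with centred moments `≤ M₂, M₄, M₆`, satisfy for
# every truncation level `R > 0`, CLAMPING EVERY FACTOR:
#   `1|4`:  `|E[f₁f₂f₃f₄f₅]| ≤ R³·Σ_w(Dᵀa₁)_w(Dᵀ(a₂+⋯+a₅))_w∕c_w + (5M₆ + M₂M₄)∕R`     (`m₁ = E F₁`: the clamp of `f₁` re-centres at cost `M₂∕R`);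
#   `2|3`:  `|E[f₁⋯f₅] − E[f₁f₂]E[f₃f₄f₅]| ≤ R³·Σ_w(Dᵀ(a₁+a₂))_w(Dᵀ(a₃+a₄+a₅))_w∕c_w + (5M₆ + (M₂+M₄)²∕2 + 3M₂M₄)∕R`
# — `E[Πf] = (E[Πf] − E[ΠT]) + Cov(clamped groups) + (products of clamped∕unclamped group moments)`: (541)'s five-factor defect `5M₆∕R`, (542)'s
# Dobrushin bounds, (541)'s re-centring cost, (486)'s pair pieces and (543)'s triple∕quadruple pieces.  SIXTH MOMENTS ONLY.  With `R` a power of the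
# least crossing weight these are the two generic CUT BOUNDS of the fifth cumulant (next file: power bookkeeping, (540)'s algebra, (539)'s threshold)
# (row NE7b, node U5c; (541), (542), (543), (486) BY NAME; [folklore])

Cell `pub-balaban`, sub-cell `t4`, spine estimate NE7b (`T4WeightBudget.RelWeightBound`; the cell's OWN estimate — NOT PRINTED in
[Bałaban 1983–89], NOT PROVED).  Crux-route work under `Spine/NE7b/` by the row OWNER (`t4-ne7b-p1` gen 142, file (544)) under FREEZE
(0)'s crux-prover clause; NOTHING of Bałaban's is named as a Lean object, valued or asserted; no `T4Continuum/Support` leaf typed; no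
`def`, no notation; zero `sorry`.  Imports (BY NAME): the OWNER's (541) `…SupTruncationFiveBound` (`quint_expect_defect_le`, `abs_expect_clamp_le`),
(543) `…SupTruncationFiveMoments` (`abs_expect_clamped_quad_le`, `abs_expect_clamped_triple_le`, `triple_expect_defect_le`), (542)
`…SupDobrushinGroupCovarianceFive` (`clamped_single_quad_cov_le`, `clamped_pair_triple_cov_le`); (486) `pair_expect_defect_le`, `abs_expect_pair_le`,
(446) `memLp_coord_tilted`, (445) `SupCoordinateLipschitzClass.*` through them.

WHAT IS PROVED ([folklore]): §1 `abs_le_of_pieces`, `abs_sub_prod_le_of_pieces` (the two assembling triangles); §2 THE ENDS **`group_cov_one_four_le`**,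
**`group_cov_two_three_le`**; §3 toy.

HONEST (what this is NOT).  The two generic group bounds; the power bookkeeping (`R` = a power of the least crossing weight, the crossing forms'
decay by (466)), the fifteen instantiations into (540)∕(539)∕(537), the whitened fifth cumulant and its kernel letter by (538) are the successor's;
the cumulant FORM of `∂⁵W` is NOT typed; scalar skeleton ((A3), NC-NE7b-α UNRULED); nothing of Bałaban's asserted.  BY-NAME EFFECT ON THE WALL:
NONE.  NE7b NOT PRINTED ∕ NOT PROVED; spine PROVED 0∕9; rung (B)+1 — FINITE-torus statements; NOT the mass gap, NOT Clay.  HONEST DEPENDENCY: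
continuum YM on T⁴ ⇐ BetaPertH ∧ nine spine estimates (0∕9 proved); BetaPertH ⇐ (D1) ∧ (D4) ∧ CAP+tail; G-an2-4 gates asym, D1 and NE2∕3∕4.
-/

set_option autoImplicit false

noncomputable section

namespace Summit.QuantumFields.BalabanUV.T4Continuum.NE7b.SupGroupCovarianceFive

open MeasureTheory Real Set Function Finset
open scoped BigOperators
open SupOneSiteResamplingInvariance (memLp_coord_tilted)
open SupTruncationGroupBound (pair_expect_defect_le abs_expect_pair_le)
open SupTruncationFiveBound (quint_expect_defect_le abs_expect_clamp_le)
open SupTruncationFiveMoments (abs_expect_clamped_quad_le abs_expect_clamped_triple_le triple_expect_defect_le)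
open SupDobrushinGroupCovarianceFive (clamped_single_quad_cov_le clamped_pair_triple_cov_le)

/-! ## §1. The two assembling triangles -/

/-- `|X − Y| ≤ d`, `|Y − pq| ≤ C`, `|p| ≤ A`, `|q| ≤ B` give `|X| ≤ d + C + A·B`. [folklore] -/
theorem abs_le_of_pieces {X Y p q d C A B : ℝ} (h1 : |X - Y| ≤ d) (h2 : |Y - p * q| ≤ C) (hp : |p| ≤ A) (hq : |q| ≤ B) :
    |X| ≤ d + C + A * B := by
  have hA : 0 ≤ A := (abs_nonneg _).trans hp
  have hpq : |p * q| ≤ A * B := by rw [abs_mul]; exact mul_le_mul hp hq (abs_nonneg _) hA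
  have e : X = (X - Y) + (Y - p * q) + p * q := by ring
  have t := abs_add_le ((X - Y) + (Y - p * q)) (p * q)
  have t' := abs_add_le (X - Y) (Y - p * q)
  rw [← e] at t
  linarith

/-- `|X − Y| ≤ d`, `|Y − ab| ≤ C`, `|c − a| ≤ d₃`, `|b| ≤ B`, `|c| ≤ Cc`, `|e − b| ≤ d₄` give `|X − ce| ≤ d + C + d₃·B + Cc·d₄`. [folklore] -/
theorem abs_sub_prod_le_of_pieces {X Y a b c e d C d₃ B Cc d₄ : ℝ} (h1 : |X - Y| ≤ d) (h2 : |Y - a * b| ≤ C) (h3 : |c - a| ≤ d₃) (hb : |b| ≤ B)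
    (hc : |c| ≤ Cc) (h4 : |e - b| ≤ d₄) : |X - c * e| ≤ d + C + d₃ * B + Cc * d₄ := by
  have hd3 : 0 ≤ d₃ := (abs_nonneg _).trans h3
  have hCc : 0 ≤ Cc := (abs_nonneg _).trans hc
  have p1 : |(a - c) * b| ≤ d₃ * B := by rw [abs_mul, abs_sub_comm]; exact mul_le_mul h3 hb (abs_nonneg _) hd3
  have p2 : |c * (b - e)| ≤ Cc * d₄ := by rw [abs_mul, abs_sub_comm]; exact mul_le_mul hc h4 (abs_nonneg _) hCc
  have eq : X - c * e = (X - Y) + (Y - a * b) + ((a - c) * b + c * (b - e)) := by ring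
  have t1 := abs_add_le ((X - Y) + (Y - a * b)) ((a - c) * b + c * (b - e))
  have t2 := abs_add_le (X - Y) (Y - a * b)
  have t3 := abs_add_le ((a - c) * b) (c * (b - e))
  rw [← eq] at t1
  linarith

/-! ## §2. THE ENDS: the two group bounds -/

variable {ι : Type} [Fintype ι] [DecidableEq ι]

variable {V : (ι → ℝ) → ℝ} {V₁ : ι → (ι → ℝ) → ℝ} {c : ι → ℝ} {Cw γ : ℝ} {J D : ι → ι → ℝ}
  {P : ι → ((ι → ℝ) → ℝ) → ((ι → ℝ) → ℝ)} {F₁ F₂ F₃ F₄ F₅ : (ι → ℝ) → ℝ} {a₁ a₂ a₃ a₄ a₅ : ι → ℝ}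

/-- **THE `1|4` GROUP BOUND UNDER THE GIBBS LAW**: for five class observables, the first centred at its mean and the others at arbitrary
constants (`f₁ = F₁ − E_νF₁`, `f_i = F_i − m_i`), centred moments `E f₁² ≤ M₂`, `E f_i⁴ ≤ M₄`, `E f_i⁶ ≤ M₆`, and every `R > 0`,
`|∫f₁f₂f₃f₄f₅dν| ≤ R³·Σ_w(Dᵀa₁)_w(Dᵀ(a₂+a₃+a₄+a₅))_w∕c_w + (5M₆ + M₂M₄)∕R`. [folklore] -/
theorem group_cov_one_four_le
    (hP : ∀ x F ω, P x F ω = (∫ s, F (update ω x s) * exp (-V (update ω x s))) / ∫ s, exp (-V (update ω x s)))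
    (hV : ∀ x ω, HasDerivAt (fun s => V (update ω x s)) (V₁ x ω) (ω x))
    (hfloor : ∀ x ω s t, c x * (s - t) ^ 2 ≤ (V₁ x (update ω x s) - V₁ x (update ω x t)) * (s - t)) (hc : ∀ x, 0 < c x)
    (hceil : ∀ x ω s t, |V₁ x (update ω x s) - V₁ x (update ω x t)| ≤ Cw * |s - t|)
    (hcross : ∀ x z, z ≠ x → ∀ ω s t, |V₁ x (update ω z s) - V₁ x (update ω z t)| ≤ J x z * |s - t|) (hVc : Continuous V)
    (hV0 : Integrable (fun ω : ι → ℝ => exp (-V ω))) (hV2 : ∀ z, Integrable (fun ω : ι → ℝ => ω z ^ 2 * exp (-V ω)))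
    (hJ : ∀ x z, 0 ≤ J x z) (hJ0 : ∀ x, J x x = 0) (hrow : ∀ x, ∑ z, J x z / c x ≤ γ) (hγ0 : 0 ≤ γ) (hγ1 : γ < 1)
    (hD : ∀ x y, 0 ≤ D x y) (hDC : ∀ x y, (if x = y then (1 : ℝ) else 0) + ∑ z, D x z * (J z y / c z) ≤ D x y)
    (h1 : ∀ z ω s t, |F₁ (update ω z s) - F₁ (update ω z t)| ≤ a₁ z * |s - t|)
    (h2 : ∀ z ω s t, |F₂ (update ω z s) - F₂ (update ω z t)| ≤ a₂ z * |s - t|)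
    (h3 : ∀ z ω s t, |F₃ (update ω z s) - F₃ (update ω z t)| ≤ a₃ z * |s - t|)
    (h4 : ∀ z ω s t, |F₄ (update ω z s) - F₄ (update ω z t)| ≤ a₄ z * |s - t|)
    (h5 : ∀ z ω s t, |F₅ (update ω z s) - F₅ (update ω z t)| ≤ a₅ z * |s - t|) (m₂ m₃ m₄ m₅ : ℝ) {R M₂ M₄ M₆ : ℝ} (hR : 0 < R)
    (hq1 : Integrable (fun ω => (F₁ ω - (∫ ω', F₁ ω' ∂((volume : Measure (ι → ℝ)).tilted fun ω => -V ω))) ^ 4) ((volume : Measure (ι → ℝ)).tilted fun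
        ω => -V ω))
    (hq2 : Integrable (fun ω => (F₂ ω - m₂) ^ 4) ((volume : Measure (ι → ℝ)).tilted fun ω => -V ω))
    (hq3 : Integrable (fun ω => (F₃ ω - m₃) ^ 4) ((volume : Measure (ι → ℝ)).tilted fun ω => -V ω))
    (hq4 : Integrable (fun ω => (F₄ ω - m₄) ^ 4) ((volume : Measure (ι → ℝ)).tilted fun ω => -V ω))
    (hq5 : Integrable (fun ω => (F₅ ω - m₅) ^ 4) ((volume : Measure (ι → ℝ)).tilted fun ω => -V ω))
    (hs1 : Integrable (fun ω => (F₁ ω - (∫ ω', F₁ ω' ∂((volume : Measure (ι → ℝ)).tilted fun ω => -V ω))) ^ 6) ((volume : Measure (ι → ℝ)).tilted fun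
        ω => -V ω))
    (hs2 : Integrable (fun ω => (F₂ ω - m₂) ^ 6) ((volume : Measure (ι → ℝ)).tilted fun ω => -V ω))
    (hs3 : Integrable (fun ω => (F₃ ω - m₃) ^ 6) ((volume : Measure (ι → ℝ)).tilted fun ω => -V ω))
    (hs4 : Integrable (fun ω => (F₄ ω - m₄) ^ 6) ((volume : Measure (ι → ℝ)).tilted fun ω => -V ω))
    (hs5 : Integrable (fun ω => (F₅ ω - m₅) ^ 6) ((volume : Measure (ι → ℝ)).tilted fun ω => -V ω))
    (hM21 : ∫ ω, (F₁ ω - (∫ ω', F₁ ω' ∂((volume : Measure (ι → ℝ)).tilted fun ω => -V ω))) ^ 2 ∂((volume : Measure (ι → ℝ)).tilted fun ω => -V ω) ≤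
        M₂)
    (hM42 : ∫ ω, (F₂ ω - m₂) ^ 4 ∂((volume : Measure (ι → ℝ)).tilted fun ω => -V ω) ≤ M₄)
    (hM43 : ∫ ω, (F₃ ω - m₃) ^ 4 ∂((volume : Measure (ι → ℝ)).tilted fun ω => -V ω) ≤ M₄)
    (hM44 : ∫ ω, (F₄ ω - m₄) ^ 4 ∂((volume : Measure (ι → ℝ)).tilted fun ω => -V ω) ≤ M₄)
    (hM45 : ∫ ω, (F₅ ω - m₅) ^ 4 ∂((volume : Measure (ι → ℝ)).tilted fun ω => -V ω) ≤ M₄)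
    (hM61 : ∫ ω, (F₁ ω - (∫ ω', F₁ ω' ∂((volume : Measure (ι → ℝ)).tilted fun ω => -V ω))) ^ 6 ∂((volume : Measure (ι → ℝ)).tilted fun ω => -V ω) ≤
        M₆)
    (hM62 : ∫ ω, (F₂ ω - m₂) ^ 6 ∂((volume : Measure (ι → ℝ)).tilted fun ω => -V ω) ≤ M₆)
    (hM63 : ∫ ω, (F₃ ω - m₃) ^ 6 ∂((volume : Measure (ι → ℝ)).tilted fun ω => -V ω) ≤ M₆)
    (hM64 : ∫ ω, (F₄ ω - m₄) ^ 6 ∂((volume : Measure (ι → ℝ)).tilted fun ω => -V ω) ≤ M₆)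
    (hM65 : ∫ ω, (F₅ ω - m₅) ^ 6 ∂((volume : Measure (ι → ℝ)).tilted fun ω => -V ω) ≤ M₆) :
    |∫ ω, (F₁ ω - (∫ ω', F₁ ω' ∂((volume : Measure (ι → ℝ)).tilted fun ω => -V ω))) * (F₂ ω - m₂) * (F₃ ω - m₃) * (F₄ ω - m₄) * (F₅ ω - m₅) ∂((volume
        : Measure (ι → ℝ)).tilted fun ω => -V ω)| ≤
      R ^ 3 * (∑ w, (∑ z, D z w * a₁ z) * ((∑ z, D z w * a₂ z) + (∑ z, D z w * a₃ z) + (∑ z, D z w * a₄ z) + ∑ z, D z w * a₅ z) / c w) + (5 * M₆ + M₂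
          * M₄) / R := by
  set ν : Measure (ι → ℝ) := ((volume : Measure (ι → ℝ)).tilted fun ω => -V ω) with hν
  haveI : IsProbabilityMeasure ν := isProbabilityMeasure_tilted hV0
  have hμ2 : ∀ z, MemLp (fun ω : ι → ℝ => ω z) 2 ν := memLp_coord_tilted hV0 hV2
  set mF : ℝ := ∫ ω', F₁ ω' ∂ν with hmF
  have hm1 : Measurable fun ω => F₁ ω - mF := (SupCoordinateLipschitzClass.measurable h1).sub_const mF
  have hm2 : Measurable fun ω => F₂ ω - m₂ := (SupCoordinateLipschitzClass.measurable h2).sub_const m₂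
  have hm3 : Measurable fun ω => F₃ ω - m₃ := (SupCoordinateLipschitzClass.measurable h3).sub_const m₃
  have hm4 : Measurable fun ω => F₄ ω - m₄ := (SupCoordinateLipschitzClass.measurable h4).sub_const m₄
  have hm5 : Measurable fun ω => F₅ ω - m₅ := (SupCoordinateLipschitzClass.measurable h5).sub_const m₅
  -- (541): the five-factor defect
  have hdef := quint_expect_defect_le (μ := ν) (f := fun ω => F₁ ω - mF) (g := fun ω => F₂ ω - m₂) (h := fun ω => F₃ ω - m₃)
    (k := fun ω => F₄ ω - m₄) (l := fun ω => F₅ ω - m₅) hm1 hm2 hm3 hm4 hm5 hR hs1 hs2 hs3 hs4 hs5 hq4 hq5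
  have e5 : ∀ ω, max (-R) (min R (F₁ ω - mF)) * max (-R) (min R (F₂ ω - m₂)) * max (-R) (min R (F₃ ω - m₃)) * max (-R) (min R (F₄ ω - m₄)) *
      max (-R) (min R (F₅ ω - m₅)) = max (-R) (min R (F₁ ω - mF)) * (max (-R) (min R (F₂ ω - m₂)) * max (-R) (min R (F₃ ω - m₃)) *
      max (-R) (min R (F₄ ω - m₄)) * max (-R) (min R (F₅ ω - m₅))) := fun ω => by ring
  simp_rw [e5] at hdef
  -- (542): Dobrushin for the clamped `1|4` pair
  have hcov := clamped_single_quad_cov_le hP hV hfloor hc hceil hcross hVc hV0 hV2 hJ hJ0 hrow hγ0 hγ1 hD hDC h1 h2 h3 h4 h5 mF m₂ m₃ m₄ m₅ hR.le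
  -- (541): the re-centring cost of the first clamp; (543): the clamped quadruple moment
  have hIF : Integrable F₁ ν := SupCoordinateLipschitzClass.integrable h1 hμ2
  have hf0 : ∫ ω, (F₁ ω - mF) ∂ν = 0 := by rw [integral_sub hIF (integrable_const mF), integral_const, probReal_univ, one_smul, hmF, sub_self]
  have hc1 := abs_expect_clamp_le (μ := ν) (f := fun ω => F₁ ω - mF) hm1 hR hq1 hf0
  have hTQ := abs_expect_clamped_quad_le (μ := ν) (f := fun ω => F₂ ω - m₂) (g := fun ω => F₃ ω - m₃) (h := fun ω => F₄ ω - m₄)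
    (k := fun ω => F₅ ω - m₅) hR.le hq2 hq3 hq4 hq5
  have hM2nn : 0 ≤ M₂ := le_trans (integral_nonneg fun ω => sq_nonneg _) hM21
  have hdef' := hdef.trans (div_le_div_of_nonneg_right (show _ ≤ 5 * M₆ by linarith [hM61, hM62, hM63, hM64, hM65]) hR.le)
  have hc1' := hc1.trans (div_le_div_of_nonneg_right hM21 hR.le)
  have hTQ' := hTQ.trans (show _ ≤ M₄ by linarith [hM42, hM43, hM44, hM45])
  have key := abs_le_of_pieces hdef' hcov hc1' hTQ'
  linarith [key, show (5 * M₆ + M₂ * M₄) / R = 5 * M₆ / R + M₂ / R * M₄ from by ring]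

/-- **THE `2|3` GROUP BOUND UNDER THE GIBBS LAW**: for five class observables centred at arbitrary constants (`f_i = F_i − m_i`), centred moments
`E f_i² ≤ M₂` (`i ≤ 3`), `E f_i⁴ ≤ M₄`, `E f_i⁶ ≤ M₆`, and every `R > 0`,
`|∫f₁⋯f₅dν − (∫f₁f₂)(∫f₃f₄f₅)| ≤ R³·Σ_w(Dᵀ(a₁+a₂))_w(Dᵀ(a₃+a₄+a₅))_w∕c_w + (5M₆ + (M₂+M₄)²∕2 + 3M₂M₄)∕R`. [folklore] -/
theorem group_cov_two_three_le
    (hP : ∀ x F ω, P x F ω = (∫ s, F (update ω x s) * exp (-V (update ω x s))) / ∫ s, exp (-V (update ω x s)))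
    (hV : ∀ x ω, HasDerivAt (fun s => V (update ω x s)) (V₁ x ω) (ω x))
    (hfloor : ∀ x ω s t, c x * (s - t) ^ 2 ≤ (V₁ x (update ω x s) - V₁ x (update ω x t)) * (s - t)) (hc : ∀ x, 0 < c x)
    (hceil : ∀ x ω s t, |V₁ x (update ω x s) - V₁ x (update ω x t)| ≤ Cw * |s - t|)
    (hcross : ∀ x z, z ≠ x → ∀ ω s t, |V₁ x (update ω z s) - V₁ x (update ω z t)| ≤ J x z * |s - t|) (hVc : Continuous V)
    (hV0 : Integrable (fun ω : ι → ℝ => exp (-V ω))) (hV2 : ∀ z, Integrable (fun ω : ι → ℝ => ω z ^ 2 * exp (-V ω)))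
    (hJ : ∀ x z, 0 ≤ J x z) (hJ0 : ∀ x, J x x = 0) (hrow : ∀ x, ∑ z, J x z / c x ≤ γ) (hγ0 : 0 ≤ γ) (hγ1 : γ < 1)
    (hD : ∀ x y, 0 ≤ D x y) (hDC : ∀ x y, (if x = y then (1 : ℝ) else 0) + ∑ z, D x z * (J z y / c z) ≤ D x y)
    (h1 : ∀ z ω s t, |F₁ (update ω z s) - F₁ (update ω z t)| ≤ a₁ z * |s - t|)
    (h2 : ∀ z ω s t, |F₂ (update ω z s) - F₂ (update ω z t)| ≤ a₂ z * |s - t|)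
    (h3 : ∀ z ω s t, |F₃ (update ω z s) - F₃ (update ω z t)| ≤ a₃ z * |s - t|)
    (h4 : ∀ z ω s t, |F₄ (update ω z s) - F₄ (update ω z t)| ≤ a₄ z * |s - t|)
    (h5 : ∀ z ω s t, |F₅ (update ω z s) - F₅ (update ω z t)| ≤ a₅ z * |s - t|) (m₁ m₂ m₃ m₄ m₅ : ℝ) {R M₂ M₄ M₆ : ℝ} (hR : 0 < R)
    (hq1 : Integrable (fun ω => (F₁ ω - m₁) ^ 4) ((volume : Measure (ι → ℝ)).tilted fun ω => -V ω))
    (hq2 : Integrable (fun ω => (F₂ ω - m₂) ^ 4) ((volume : Measure (ι → ℝ)).tilted fun ω => -V ω))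
    (hq3 : Integrable (fun ω => (F₃ ω - m₃) ^ 4) ((volume : Measure (ι → ℝ)).tilted fun ω => -V ω))
    (hq4 : Integrable (fun ω => (F₄ ω - m₄) ^ 4) ((volume : Measure (ι → ℝ)).tilted fun ω => -V ω))
    (hq5 : Integrable (fun ω => (F₅ ω - m₅) ^ 4) ((volume : Measure (ι → ℝ)).tilted fun ω => -V ω))
    (hs1 : Integrable (fun ω => (F₁ ω - m₁) ^ 6) ((volume : Measure (ι → ℝ)).tilted fun ω => -V ω))
    (hs2 : Integrable (fun ω => (F₂ ω - m₂) ^ 6) ((volume : Measure (ι → ℝ)).tilted fun ω => -V ω))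
    (hs3 : Integrable (fun ω => (F₃ ω - m₃) ^ 6) ((volume : Measure (ι → ℝ)).tilted fun ω => -V ω))
    (hs4 : Integrable (fun ω => (F₄ ω - m₄) ^ 6) ((volume : Measure (ι → ℝ)).tilted fun ω => -V ω))
    (hs5 : Integrable (fun ω => (F₅ ω - m₅) ^ 6) ((volume : Measure (ι → ℝ)).tilted fun ω => -V ω))
    (hM21 : ∫ ω, (F₁ ω - m₁) ^ 2 ∂((volume : Measure (ι → ℝ)).tilted fun ω => -V ω) ≤ M₂)
    (hM22 : ∫ ω, (F₂ ω - m₂) ^ 2 ∂((volume : Measure (ι → ℝ)).tilted fun ω => -V ω) ≤ M₂)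
    (hM23 : ∫ ω, (F₃ ω - m₃) ^ 2 ∂((volume : Measure (ι → ℝ)).tilted fun ω => -V ω) ≤ M₂)
    (hM41 : ∫ ω, (F₁ ω - m₁) ^ 4 ∂((volume : Measure (ι → ℝ)).tilted fun ω => -V ω) ≤ M₄)
    (hM42 : ∫ ω, (F₂ ω - m₂) ^ 4 ∂((volume : Measure (ι → ℝ)).tilted fun ω => -V ω) ≤ M₄)
    (hM43 : ∫ ω, (F₃ ω - m₃) ^ 4 ∂((volume : Measure (ι → ℝ)).tilted fun ω => -V ω) ≤ M₄)
    (hM44 : ∫ ω, (F₄ ω - m₄) ^ 4 ∂((volume : Measure (ι → ℝ)).tilted fun ω => -V ω) ≤ M₄)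
    (hM45 : ∫ ω, (F₅ ω - m₅) ^ 4 ∂((volume : Measure (ι → ℝ)).tilted fun ω => -V ω) ≤ M₄)
    (hM61 : ∫ ω, (F₁ ω - m₁) ^ 6 ∂((volume : Measure (ι → ℝ)).tilted fun ω => -V ω) ≤ M₆)
    (hM62 : ∫ ω, (F₂ ω - m₂) ^ 6 ∂((volume : Measure (ι → ℝ)).tilted fun ω => -V ω) ≤ M₆)
    (hM63 : ∫ ω, (F₃ ω - m₃) ^ 6 ∂((volume : Measure (ι → ℝ)).tilted fun ω => -V ω) ≤ M₆)
    (hM64 : ∫ ω, (F₄ ω - m₄) ^ 6 ∂((volume : Measure (ι → ℝ)).tilted fun ω => -V ω) ≤ M₆)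
    (hM65 : ∫ ω, (F₅ ω - m₅) ^ 6 ∂((volume : Measure (ι → ℝ)).tilted fun ω => -V ω) ≤ M₆) :
    |(∫ ω, (F₁ ω - m₁) * (F₂ ω - m₂) * (F₃ ω - m₃) * (F₄ ω - m₄) * (F₅ ω - m₅) ∂((volume : Measure (ι → ℝ)).tilted fun ω => -V ω)) -
        (∫ ω, (F₁ ω - m₁) * (F₂ ω - m₂) ∂((volume : Measure (ι → ℝ)).tilted fun ω => -V ω)) * (∫ ω, (F₃ ω - m₃) * (F₄ ω - m₄) * (F₅ ω - m₅) ∂((volume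
            : Measure (ι → ℝ)).tilted fun ω => -V ω))| ≤
      R ^ 3 * (∑ w, ((∑ z, D z w * a₁ z) + ∑ z, D z w * a₂ z) * ((∑ z, D z w * a₃ z) + (∑ z, D z w * a₄ z) + ∑ z, D z w * a₅ z) / c w) + (5 * M₆ +
          (M₂ + M₄) ^ 2 / 2 + 3 * M₂ * M₄) / R := by
  set ν : Measure (ι → ℝ) := ((volume : Measure (ι → ℝ)).tilted fun ω => -V ω) with hν
  haveI : IsProbabilityMeasure ν := isProbabilityMeasure_tilted hV0
  have hm1 : Measurable fun ω => F₁ ω - m₁ := (SupCoordinateLipschitzClass.measurable h1).sub_const m₁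
  have hm2 : Measurable fun ω => F₂ ω - m₂ := (SupCoordinateLipschitzClass.measurable h2).sub_const m₂
  have hm3 : Measurable fun ω => F₃ ω - m₃ := (SupCoordinateLipschitzClass.measurable h3).sub_const m₃
  have hm4 : Measurable fun ω => F₄ ω - m₄ := (SupCoordinateLipschitzClass.measurable h4).sub_const m₄
  have hm5 : Measurable fun ω => F₅ ω - m₅ := (SupCoordinateLipschitzClass.measurable h5).sub_const m₅
  -- (541): the five-factor defect, re-associated as `(T₁T₂)(T₃T₄T₅)`
  have hdef := quint_expect_defect_le (μ := ν) (f := fun ω => F₁ ω - m₁) (g := fun ω => F₂ ω - m₂) (h := fun ω => F₃ ω - m₃)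
    (k := fun ω => F₄ ω - m₄) (l := fun ω => F₅ ω - m₅) hm1 hm2 hm3 hm4 hm5 hR hs1 hs2 hs3 hs4 hs5 hq4 hq5
  have e5 : ∀ ω, max (-R) (min R (F₁ ω - m₁)) * max (-R) (min R (F₂ ω - m₂)) * max (-R) (min R (F₃ ω - m₃)) * max (-R) (min R (F₄ ω - m₄)) *
      max (-R) (min R (F₅ ω - m₅)) = (max (-R) (min R (F₁ ω - m₁)) * max (-R) (min R (F₂ ω - m₂))) * (max (-R) (min R (F₃ ω - m₃)) *
      max (-R) (min R (F₄ ω - m₄)) * max (-R) (min R (F₅ ω - m₅))) := fun ω => by ring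
  simp_rw [e5] at hdef
  -- (542): Dobrushin for the clamped `2|3` pair
  have hcov := clamped_pair_triple_cov_le hP hV hfloor hc hceil hcross hVc hV0 hV2 hJ hJ0 hrow hγ0 hγ1 hD hDC h1 h2 h3 h4 h5 m₁ m₂ m₃ m₄ m₅ hR.le
  -- (486)/(543): pair defect, pair moment, clamped triple moment, triple defect
  have hPd := pair_expect_defect_le (μ := ν) (f := fun ω => F₁ ω - m₁) (g := fun ω => F₂ ω - m₂) hm1 hm2 hR hq1 hq2
  have hPm := abs_expect_pair_le (μ := ν) (f := fun ω => F₁ ω - m₁) (g := fun ω => F₂ ω - m₂) hm1 hm2 hq1 hq2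
  have hTT := abs_expect_clamped_triple_le (μ := ν) (f := fun ω => F₃ ω - m₃) (g := fun ω => F₄ ω - m₄) (h := fun ω => F₅ ω - m₅) hm3 hR.le hq3
    hq4 hq5
  have hTd := triple_expect_defect_le (μ := ν) (f := fun ω => F₃ ω - m₃) (g := fun ω => F₄ ω - m₄) (h := fun ω => F₅ ω - m₅) hm3 hm4 hm5 hR
    hq3 hq4 hq5
  have hdef' := hdef.trans (div_le_div_of_nonneg_right (show _ ≤ 5 * M₆ by linarith [hM61, hM62, hM63, hM64, hM65]) hR.le)
  have hPd' : |(∫ ω, (F₁ ω - m₁) * (F₂ ω - m₂) ∂ν) - ∫ ω, max (-R) (min R (F₁ ω - m₁)) * max (-R) (min R (F₂ ω - m₂)) ∂ν| ≤ (M₂ + M₄) / R :=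
    calc _ ≤ (2 * (M₂ + M₄)) / (2 * R) := hPd.trans (div_le_div_of_nonneg_right (by linarith [hM41, hM22, hM42, hM21]) (by positivity))
      _ = (M₂ + M₄) / R := mul_div_mul_left _ _ two_ne_zero
  have hPm' := hPm.trans (show _ ≤ M₂ by linarith [hM21, hM22])
  have hTT' := hTT.trans (show _ ≤ (M₂ + M₄) / 2 by linarith [hM23, hM44, hM45])
  have hTd' := hTd.trans (div_le_div_of_nonneg_right (show _ ≤ 3 * M₄ by linarith [hM43, hM44, hM45]) hR.le)
  have key := abs_sub_prod_le_of_pieces hdef' hcov hPd' hTT' hPm' hTd'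
  linarith [key, show (5 * M₆ + (M₂ + M₄) ^ 2 / 2 + 3 * M₂ * M₄) / R = 5 * M₆ / R + (M₂ + M₄) / R * ((M₂ + M₄) / 2) + M₂ * (3 * M₄ / R)
    from by ring]

/-! ## §3. Toy -/

/-- Toy (§1): exact pieces give `|X| ≤ 0 + 0 + 1·1` for `X = Y = pq`, `p = q = 1`. -/
example : |(1 : ℝ)| ≤ 0 + 0 + 1 * 1 :=
  abs_le_of_pieces (X := 1) (Y := 1) (p := 1) (q := 1) (by simp) (by simp) (by simp) (by simp)

end Summit.QuantumFields.BalabanUV.T4Continuum.NE7b.SupGroupCovarianceFive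

end
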